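import Mathlib

/-!
# `MatrixDescartes` — line «osculation_law», stub `stub_peel` at `r = 3`: a TRIPLE root (or triple escape) of a real-rooted
# cubic pencil costs three orders of vanishing of the end coefficient

HONEST FRAMING.  Helper file (`--supports stmt-ValiantsHypothesis-18050 --as helper`; val-port-4 g1, val-lit merged desk g12 RULING #271 (b),
HAND from val-lit-p7 g12: the piece (β2) at `m = 3`, `r = 3` of the sizing memo `HOME/lmr/NOTE-p7g12-peel-general-r-sizing.md` §3; the two
signatures are p7's staged `p7g12-HANDOVER-port4-TripleRoot.sig.lean`, token for token).  Elementary real algebra (the cubic DISCRIMINANT of a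
one-parameter family of real-rooted cubics); nothing here bears on the crux `Summit.ValiantsHypothesis.ValiantsHypothesis.Theses.LacunarySymmetroid.
MatrixDescartes` (stmt-ValiantsHypothesis-18050), on `DoorA26`, on Conjecture B or on VP ≠ VNP.  No Theses import, no new definitions.

STATEMENT.  A family of real polynomials `p_t(x) = a₃(t) x³ + a₂(t) x² + a₁(t) x + a₀(t)` with POLYNOMIAL coefficients `aᵢ ∈ ℝ[t]`, real-rooted
(`Splits` over `ℝ`) for every `t > 0`.  (1) `three_le_rootMultiplicity_of_triple_root`: if at some `t* > 0` the three low coefficients vanish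
(`a₀(t*) = a₁(t*) = a₂(t*) = 0`, a triple root at `x = 0`) while `a₃(t*) ≠ 0` and `a₀ ≢ 0`, then `a₀` vanishes to order `≥ 3` at `t*`.
(2) `three_le_rootMultiplicity_of_triple_escape`: symmetrically (`a₀ ↔ a₃`: a triple ESCAPE to infinity), if `a₃(t*) = a₂(t*) = a₁(t*) = 0`,
`a₀(t*) ≠ 0`, `a₃ ≢ 0`, then `a₃` vanishes to order `≥ 3` at `t*`.

PROOF (p7's discriminant table, made algebraic).  `Disc = a₂²a₁² − 4a₃a₁³ − 4a₂³a₀ − 27a₃²a₀² + 18a₃a₂a₁a₀ ∈ ℝ[t]` is `≥ 0` at every `t > 0`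
(`discr_nonneg_of_splits`: for a genuine cubic it is `a₃⁴·Π(rᵢ − rⱼ)²` by Mathlib's `Cubic.discr_eq_prod_three_roots`; for `a₃(t) = 0` it is
`a₂²·(a₁² − 4a₂a₀) = a₂²·(2a₂x + a₁)²` at a real root `x` of the quadratic; for `a₃ = a₂ = 0` it is `0`).  Write `a₀ = (t − t*)^k·q`,
`q(t*) ≠ 0`, `a₁ = (t − t*)·p₁`, `a₂ = (t − t*)·p₂`.  If `k = 1`, `Disc = (t − t*)²·E` with `E(t*) = −27·a₃(t*)²·q(t*)² < 0`; if `k = 2`,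
`Disc = (t − t*)³·F` with `F(t*) = −4·a₃(t*)·p₁(t*)³` — an odd-order SIGN CHANGE at the interior point `t* > 0` unless `p₁(t*) = 0`, and then
`Disc = (t − t*)⁴·G` with `G(t*) = −27·a₃(t*)²·q(t*)² < 0`.  In each case `Disc < 0` at some `t > 0` near `t*` (`exists_pos_eval_neg`),
contradicting real-rootedness; hence `k ≥ 3`.  The escape is the same computation with `a₀ ↔ a₃` and `p₂` in place of `p₁` (the discriminant
is invariant under coefficient reversal).  [folklore] (cubic discriminant; orders of vanishing)
-/

-- `Summit.ValiantsHypothesis.ValiantsHypothesis.…` repeats a component by the D-0017 layout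
-- (single-conjunct summit), which the `dupNamespace` linter flags; the name is mandated.
set_option linter.dupNamespace false

open Polynomial

namespace Summit.ValiantsHypothesis.ValiantsHypothesis.Theorems.LacunarySymmetroidMatrixDescartes.OsculationPeel

/-! ## 1. The discriminant of a real-rooted (sub)cubic is non-negative -/

/-- **Discriminant of a split real cubic-or-lower is `≥ 0`.**  If `a X³ + b X² + c X + d ∈ ℝ[X]` splits over `ℝ` then
`b²c² − 4ac³ − 4b³d − 27a²d² + 18abcd ≥ 0` — for `a ≠ 0` this is `a⁴ Π (rᵢ − rⱼ)²` (Mathlib `Cubic.discr_eq_prod_three_roots`), for `a = 0 ≠ b`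
it is `b²·(2bx + c)²` at a real root `x` of the quadratic, and for `a = b = 0` it is `0`. [folklore] -/
theorem discr_nonneg_of_splits (a b c d : ℝ) (h : (C a * X ^ 3 + C b * X ^ 2 + C c * X + C d).Splits) :
    0 ≤ b ^ 2 * c ^ 2 - 4 * a * c ^ 3 - 4 * b ^ 3 * d - 27 * a ^ 2 * d ^ 2 + 18 * a * b * c * d := by
  by_cases ha : a ≠ 0
  · let P : Cubic ℝ := ⟨a, b, c, d⟩
    have hPa : P.a ≠ 0 := ha
    have hs : (P.toPoly.map (RingHom.id ℝ)).Splits := by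
      rw [Polynomial.map_id]
      exact h
    obtain ⟨x, y, z, h3⟩ := (Cubic.splits_iff_roots_eq_three hPa).mp hs
    have hd := Cubic.discr_eq_prod_three_roots hPa h3
    have hdisc : P.discr = b ^ 2 * c ^ 2 - 4 * a * c ^ 3 - 4 * b ^ 3 * d - 27 * a ^ 2 * d ^ 2 + 18 * a * b * c * d := by
      simp only [Cubic.discr, P]
    rw [← hdisc]
    calc (0 : ℝ) ≤ ((RingHom.id ℝ) P.a * (RingHom.id ℝ) P.a * (x - y) * (x - z) * (y - z)) ^ 2 := sq_nonneg _
      _ = P.discr := hd.symm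
  · push Not at ha
    subst ha
    by_cases hb : b = 0
    · subst hb
      simp
    · -- a split quadratic `b X² + c X + d`, `b ≠ 0`, has a real root `x`; then `c² − 4bd = (2bx + c)²`.
      have hq : (C b * X ^ 2 + C c * X + C d).Splits := by simpa using h
      have hne : (C b * X ^ 2 + C c * X + C d) ≠ 0 := by
        intro h0
        have := congrArg (fun p => p.coeff 2) h0
        simp at this
        exact hb this
      have hdeg : (C b * X ^ 2 + C c * X + C d).natDegree = 2 := by
        compute_degree!
      have hcard : (C b * X ^ 2 + C c * X + C d).roots.card = 2 := by
        rw [Polynomial.splits_iff_card_roots.mp hq, hdeg]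
      obtain ⟨x, hx⟩ := Multiset.card_pos_iff_exists_mem.mp (by omega : 0 < (C b * X ^ 2 + C c * X + C d).roots.card)
      have hroot : b * (x * x) + c * x + d = 0 := by
        have := (mem_roots hne).mp hx
        simp only [IsRoot.def, eval_add, eval_mul, eval_C, eval_pow, eval_X] at this
        linarith [this]
      have hsq : discrim b c d = (2 * b * x + c) ^ 2 := discrim_eq_sq_of_quadratic_eq_zero hroot
      simp only [discrim] at hsq
      nlinarith [sq_nonneg (2 * b * x + c), sq_nonneg b, mul_nonneg (sq_nonneg b) (sq_nonneg (2 * b * x + c)), hsq]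

/-- The discriminant of the pencil `a₃(t)X³ + a₂(t)X² + a₁(t)X + a₀(t)`, as a polynomial in `t`, evaluates to the discriminant of the
cubic at `t`; hence it is `≥ 0` wherever the cubic splits over `ℝ`. [folklore] -/
theorem eval_discrPoly_nonneg (a₀ a₁ a₂ a₃ : ℝ[X]) (t : ℝ)
    (h : (C (a₃.eval t) * X ^ 3 + C (a₂.eval t) * X ^ 2 + C (a₁.eval t) * X + C (a₀.eval t)).Splits) :
    0 ≤ (a₂ ^ 2 * a₁ ^ 2 - 4 * a₃ * a₁ ^ 3 - 4 * a₂ ^ 3 * a₀ - 27 * a₃ ^ 2 * a₀ ^ 2 + 18 * a₃ * a₂ * a₁ * a₀).eval t := by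
  have h1 := discr_nonneg_of_splits (a₃.eval t) (a₂.eval t) (a₁.eval t) (a₀.eval t) h
  simp only [eval_add, eval_sub, eval_mul, eval_pow, eval_ofNat]
  linarith [h1]

/-! ## 2. A sign lemma: a factor `(t − t*)^j · H` with `H(t*) < 0` (or `j` odd, `H(t*) ≠ 0`) is negative somewhere on `t > 0` -/

/-- If `D = (X − C t*)^j · H` with `t* > 0` and either `H(t*) < 0`, or `j` odd and `H(t*) ≠ 0`, then `D` takes a NEGATIVE value at some
`t > 0` (continuity of `H` near the interior point `t*`; for odd `j` use the side of `t*` on which `(t − t*)^j` has the sign opposite to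
`H(t*)`). [folklore] -/
theorem exists_pos_eval_neg {D H : ℝ[X]} {tstar : ℝ} (htstar : 0 < tstar) {j : ℕ}
    (hDH : D = (X - C tstar) ^ j * H) (hH : H.eval tstar < 0 ∨ (Odd j ∧ H.eval tstar ≠ 0)) :
    ∃ t : ℝ, 0 < t ∧ D.eval t < 0 := by
  have hevD : ∀ t, D.eval t = (t - tstar) ^ j * H.eval t := by
    intro t
    rw [hDH, eval_mul, eval_pow, eval_sub, eval_X, eval_C]
  have hpos : ∀ᶠ t in nhds tstar, 0 < t := lt_mem_nhds htstar
  rcases lt_trichotomy (H.eval tstar) 0 with hneg | hzero | hposH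
  · -- `H(t*) < 0`: go to the right of `t*`
    have hev : ∀ᶠ t in nhds tstar, H.eval t < 0 :=
      Filter.Tendsto.eventually_lt_const hneg (H.continuousAt (a := tstar))
    obtain ⟨ε, hε, hball⟩ := Metric.eventually_nhds_iff.mp (hpos.and hev)
    refine ⟨tstar + ε / 2, by linarith, ?_⟩
    have hmem := hball (y := tstar + ε / 2) (by
      rw [Real.dist_eq, show tstar + ε / 2 - tstar = ε / 2 by ring, abs_of_pos (by linarith)]
      linarith)
    rw [hevD, show tstar + ε / 2 - tstar = ε / 2 by ring]
    exact mul_neg_of_pos_of_neg (by positivity) hmem.2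
  · -- `H(t*) = 0` is excluded by either hypothesis
    exfalso
    rcases hH with h | ⟨_, h⟩
    · exact absurd hzero h.ne
    · exact h hzero
  · -- `H(t*) > 0`: then `j` is odd; go to the left of `t*` (still `t > 0`)
    have hodd : Odd j := by
      rcases hH with h | ⟨h, _⟩
      · exact absurd hposH (not_lt.mpr h.le)
      · exact h
    have hev : ∀ᶠ t in nhds tstar, 0 < H.eval t :=
      Filter.Tendsto.eventually_const_lt hposH (H.continuousAt (a := tstar))
    obtain ⟨ε, hε, hball⟩ := Metric.eventually_nhds_iff.mp (hpos.and hev)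
    have hmem := hball (y := tstar - ε / 2) (by
      rw [Real.dist_eq, show tstar - ε / 2 - tstar = -(ε / 2) by ring, abs_neg, abs_of_pos (by linarith)]
      linarith)
    refine ⟨tstar - ε / 2, hmem.1, ?_⟩
    rw [hevD, show tstar - ε / 2 - tstar = -(ε / 2) by ring]
    exact mul_neg_of_neg_of_pos (hodd.pow_neg (by linarith)) hmem.2

/-! ## 3. The triple root -/

/-- **(β2) at `m = 3`, `r = 3` — a triple ROOT costs three orders of the constant coefficient.**  For a family of real-rooted
(sub)cubics `a₃(t)X³ + a₂(t)X² + a₁(t)X + a₀(t)` (`t > 0`, polynomial coefficients), if `a₀(t*) = a₁(t*) = a₂(t*) = 0 ≠ a₃(t*)` at an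
interior `t* > 0` and `a₀ ≢ 0`, then `(t − t*)³ ∣ a₀`.  (HAND-OVER signature of val-lit-p7 g12, verbatim.) [folklore] -/
theorem three_le_rootMultiplicity_of_triple_root (a₀ a₁ a₂ a₃ : ℝ[X]) {tstar : ℝ} (htstar : 0 < tstar)
    (hsplit : ∀ t : ℝ, 0 < t →
      (C (a₃.eval t) * X ^ 3 + C (a₂.eval t) * X ^ 2 + C (a₁.eval t) * X + C (a₀.eval t)).Splits)
    (ha₀ : a₀ ≠ 0) (ha₃ : a₃.eval tstar ≠ 0)
    (h0 : a₀.eval tstar = 0) (h1 : a₁.eval tstar = 0) (h2 : a₂.eval tstar = 0) :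
    3 ≤ a₀.rootMultiplicity tstar := by
  -- the discriminant polynomial is non-negative on `t > 0`
  have hD : ∀ t, 0 < t →
      0 ≤ (a₂ ^ 2 * a₁ ^ 2 - 4 * a₃ * a₁ ^ 3 - 4 * a₂ ^ 3 * a₀ - 27 * a₃ ^ 2 * a₀ ^ 2
        + 18 * a₃ * a₂ * a₁ * a₀).eval t :=
    fun t ht => eval_discrPoly_nonneg a₀ a₁ a₂ a₃ t (hsplit t ht)
  -- factor the coefficients at `t*`
  obtain ⟨q, hq, hqdvd⟩ := exists_eq_pow_rootMultiplicity_mul_and_not_dvd a₀ ha₀ tstar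
  have hqt : q.eval tstar ≠ 0 := fun hq0 => hqdvd (dvd_iff_isRoot.mpr hq0)
  obtain ⟨p₁, hp₁⟩ := dvd_iff_isRoot.mpr (show a₁.IsRoot tstar from h1)
  obtain ⟨p₂, hp₂⟩ := dvd_iff_isRoot.mpr (show a₂.IsRoot tstar from h2)
  have hk1 : 1 ≤ a₀.rootMultiplicity tstar := (rootMultiplicity_pos ha₀).mpr h0
  by_contra hlt
  push Not at hlt
  -- so the multiplicity `k` is `1` or `2`
  set k := a₀.rootMultiplicity tstar with hk
  rcases (show k = 1 ∨ k = 2 by omega) with hk' | hk'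
  · -- k = 1 : Disc = (X − C t*)² · E, E(t*) = −27 a₃(t*)² q(t*)² < 0
    rw [hk', pow_one] at hq
    obtain ⟨t, ht, hneg⟩ := exists_pos_eval_neg (j := 2) htstar
      (D := a₂ ^ 2 * a₁ ^ 2 - 4 * a₃ * a₁ ^ 3 - 4 * a₂ ^ 3 * a₀ - 27 * a₃ ^ 2 * a₀ ^ 2 + 18 * a₃ * a₂ * a₁ * a₀)
      (H := (X - C tstar) ^ 2 * p₂ ^ 2 * p₁ ^ 2 - 4 * (X - C tstar) * a₃ * p₁ ^ 3
        - 4 * (X - C tstar) ^ 2 * p₂ ^ 3 * q - 27 * a₃ ^ 2 * q ^ 2 + 18 * (X - C tstar) * a₃ * p₂ * p₁ * q)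
      (by rw [hq, hp₁, hp₂]; ring)
      (Or.inl (by
        simp only [eval_add, eval_sub, eval_mul, eval_pow, eval_X, eval_C, eval_ofNat, sub_self]
        have : 0 < (a₃.eval tstar * q.eval tstar) ^ 2 := by positivity
        nlinarith [this]))
    exact absurd (hD t ht) (not_le.mpr hneg)
  · -- k = 2
    rw [hk'] at hq
    by_cases hp1t : p₁.eval tstar = 0
    · -- a₁ vanishes to second order: Disc = (X − C t*)⁴ · G, G(t*) = −27 a₃(t*)² q(t*)² < 0
      obtain ⟨p₁', hp₁'⟩ := dvd_iff_isRoot.mpr (show p₁.IsRoot tstar from hp1t)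
      obtain ⟨t, ht, hneg⟩ := exists_pos_eval_neg (j := 4) htstar
        (D := a₂ ^ 2 * a₁ ^ 2 - 4 * a₃ * a₁ ^ 3 - 4 * a₂ ^ 3 * a₀ - 27 * a₃ ^ 2 * a₀ ^ 2 + 18 * a₃ * a₂ * a₁ * a₀)
        (H := (X - C tstar) ^ 2 * p₂ ^ 2 * p₁' ^ 2 - 4 * a₃ * (X - C tstar) ^ 2 * p₁' ^ 3
          - 4 * (X - C tstar) * p₂ ^ 3 * q - 27 * a₃ ^ 2 * q ^ 2 + 18 * (X - C tstar) * a₃ * p₂ * p₁' * q)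
        (by rw [hq, hp₁, hp₁', hp₂]; ring)
        (Or.inl (by
          simp only [eval_add, eval_sub, eval_mul, eval_pow, eval_X, eval_C, eval_ofNat, sub_self]
          have : 0 < (a₃.eval tstar * q.eval tstar) ^ 2 := by positivity
          nlinarith [this]))
      exact absurd (hD t ht) (not_le.mpr hneg)
    · -- a₁ vanishes to first order exactly: Disc = (X − C t*)³ · F, F(t*) = −4 a₃(t*) p₁(t*)³ ≠ 0 — odd sign change
      obtain ⟨t, ht, hneg⟩ := exists_pos_eval_neg (j := 3) htstar
        (D := a₂ ^ 2 * a₁ ^ 2 - 4 * a₃ * a₁ ^ 3 - 4 * a₂ ^ 3 * a₀ - 27 * a₃ ^ 2 * a₀ ^ 2 + 18 * a₃ * a₂ * a₁ * a₀)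
        (H := (X - C tstar) * p₂ ^ 2 * p₁ ^ 2 - 4 * a₃ * p₁ ^ 3 - 4 * (X - C tstar) ^ 2 * p₂ ^ 3 * q
          - 27 * (X - C tstar) * a₃ ^ 2 * q ^ 2 + 18 * (X - C tstar) * a₃ * p₂ * p₁ * q)
        (by rw [hq, hp₁, hp₂]; ring)
        (Or.inr ⟨by decide, by
          simp only [eval_add, eval_sub, eval_mul, eval_pow, eval_X, eval_C, eval_ofNat, sub_self]
          have : a₃.eval tstar * p₁.eval tstar ^ 3 ≠ 0 := mul_ne_zero ha₃ (pow_ne_zero 3 hp1t)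
          intro h
          apply this
          linarith⟩)
      exact absurd (hD t ht) (not_le.mpr hneg)

/-! ## 4. The triple escape (`a₀ ↔ a₃`; the discriminant is invariant under coefficient reversal) -/

/-- **Companion — a triple ESCAPE costs three orders of the leading coefficient.**  For a family of real-rooted (sub)cubics as above,
if `a₃(t*) = a₂(t*) = a₁(t*) = 0 ≠ a₀(t*)` at an interior `t* > 0` and `a₃ ≢ 0`, then `(t − t*)³ ∣ a₃` (three roots escape to infinity:
`b ↦ 1/b` reverses the coefficients and the discriminant table is the same with `a₂` in place of `a₁`).  (HAND-OVER signature of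
val-lit-p7 g12, verbatim.) [folklore] -/
theorem three_le_rootMultiplicity_of_triple_escape (a₀ a₁ a₂ a₃ : ℝ[X]) {tstar : ℝ} (htstar : 0 < tstar)
    (hsplit : ∀ t : ℝ, 0 < t →
      (C (a₃.eval t) * X ^ 3 + C (a₂.eval t) * X ^ 2 + C (a₁.eval t) * X + C (a₀.eval t)).Splits)
    (ha₃ : a₃ ≠ 0) (ha₀ : a₀.eval tstar ≠ 0)
    (h3 : a₃.eval tstar = 0) (h2 : a₂.eval tstar = 0) (h1 : a₁.eval tstar = 0) :
    3 ≤ a₃.rootMultiplicity tstar := by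
  have hD : ∀ t, 0 < t →
      0 ≤ (a₂ ^ 2 * a₁ ^ 2 - 4 * a₃ * a₁ ^ 3 - 4 * a₂ ^ 3 * a₀ - 27 * a₃ ^ 2 * a₀ ^ 2
        + 18 * a₃ * a₂ * a₁ * a₀).eval t :=
    fun t ht => eval_discrPoly_nonneg a₀ a₁ a₂ a₃ t (hsplit t ht)
  obtain ⟨q, hq, hqdvd⟩ := exists_eq_pow_rootMultiplicity_mul_and_not_dvd a₃ ha₃ tstar
  have hqt : q.eval tstar ≠ 0 := fun hq0 => hqdvd (dvd_iff_isRoot.mpr hq0)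
  obtain ⟨p₁, hp₁⟩ := dvd_iff_isRoot.mpr (show a₁.IsRoot tstar from h1)
  obtain ⟨p₂, hp₂⟩ := dvd_iff_isRoot.mpr (show a₂.IsRoot tstar from h2)
  have hk1 : 1 ≤ a₃.rootMultiplicity tstar := (rootMultiplicity_pos ha₃).mpr h3
  by_contra hlt
  push Not at hlt
  set k := a₃.rootMultiplicity tstar with hk
  rcases (show k = 1 ∨ k = 2 by omega) with hk' | hk'
  · -- k = 1 : Disc = (X − C t*)² · E', E'(t*) = −27 q(t*)² a₀(t*)² < 0
    rw [hk', pow_one] at hq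
    obtain ⟨t, ht, hneg⟩ := exists_pos_eval_neg (j := 2) htstar
      (D := a₂ ^ 2 * a₁ ^ 2 - 4 * a₃ * a₁ ^ 3 - 4 * a₂ ^ 3 * a₀ - 27 * a₃ ^ 2 * a₀ ^ 2 + 18 * a₃ * a₂ * a₁ * a₀)
      (H := (X - C tstar) ^ 2 * p₂ ^ 2 * p₁ ^ 2 - 4 * (X - C tstar) ^ 2 * q * p₁ ^ 3
        - 4 * (X - C tstar) * p₂ ^ 3 * a₀ - 27 * q ^ 2 * a₀ ^ 2 + 18 * (X - C tstar) * q * p₂ * p₁ * a₀)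
      (by rw [hq, hp₁, hp₂]; ring)
      (Or.inl (by
        simp only [eval_add, eval_sub, eval_mul, eval_pow, eval_X, eval_C, eval_ofNat, sub_self]
        have : 0 < (q.eval tstar * a₀.eval tstar) ^ 2 := by positivity
        nlinarith [this]))
    exact absurd (hD t ht) (not_le.mpr hneg)
  · -- k = 2
    rw [hk'] at hq
    by_cases hp2t : p₂.eval tstar = 0
    · -- a₂ vanishes to second order: Disc = (X − C t*)⁴ · G', G'(t*) = −27 q(t*)² a₀(t*)² < 0
      obtain ⟨p₂', hp₂'⟩ := dvd_iff_isRoot.mpr (show p₂.IsRoot tstar from hp2t)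
      obtain ⟨t, ht, hneg⟩ := exists_pos_eval_neg (j := 4) htstar
        (D := a₂ ^ 2 * a₁ ^ 2 - 4 * a₃ * a₁ ^ 3 - 4 * a₂ ^ 3 * a₀ - 27 * a₃ ^ 2 * a₀ ^ 2 + 18 * a₃ * a₂ * a₁ * a₀)
        (H := (X - C tstar) ^ 2 * p₂' ^ 2 * p₁ ^ 2 - 4 * (X - C tstar) * q * p₁ ^ 3
          - 4 * (X - C tstar) ^ 2 * p₂' ^ 3 * a₀ - 27 * q ^ 2 * a₀ ^ 2 + 18 * (X - C tstar) * q * p₂' * p₁ * a₀)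
        (by rw [hq, hp₁, hp₂, hp₂']; ring)
        (Or.inl (by
          simp only [eval_add, eval_sub, eval_mul, eval_pow, eval_X, eval_C, eval_ofNat, sub_self]
          have : 0 < (q.eval tstar * a₀.eval tstar) ^ 2 := by positivity
          nlinarith [this]))
      exact absurd (hD t ht) (not_le.mpr hneg)
    · -- a₂ vanishes to first order exactly: Disc = (X − C t*)³ · F', F'(t*) = −4 p₂(t*)³ a₀(t*) ≠ 0 — odd sign change
      obtain ⟨t, ht, hneg⟩ := exists_pos_eval_neg (j := 3) htstar
        (D := a₂ ^ 2 * a₁ ^ 2 - 4 * a₃ * a₁ ^ 3 - 4 * a₂ ^ 3 * a₀ - 27 * a₃ ^ 2 * a₀ ^ 2 + 18 * a₃ * a₂ * a₁ * a₀)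
        (H := (X - C tstar) * p₂ ^ 2 * p₁ ^ 2 - 4 * (X - C tstar) ^ 2 * q * p₁ ^ 3 - 4 * p₂ ^ 3 * a₀
          - 27 * (X - C tstar) * q ^ 2 * a₀ ^ 2 + 18 * (X - C tstar) * q * p₂ * p₁ * a₀)
        (by rw [hq, hp₁, hp₂]; ring)
        (Or.inr ⟨by decide, by
          simp only [eval_add, eval_sub, eval_mul, eval_pow, eval_X, eval_C, eval_ofNat, sub_self]
          have : p₂.eval tstar ^ 3 * a₀.eval tstar ≠ 0 := mul_ne_zero (pow_ne_zero 3 hp2t) ha₀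
          intro h
          apply this
          linarith⟩)
      exact absurd (hD t ht) (not_le.mpr hneg)

end Summit.ValiantsHypothesis.ValiantsHypothesis.Theorems.LacunarySymmetroidMatrixDescartes.OsculationPeel
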